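import Literature.AlgebraicGeometry.Motives.MixedHodgeStructure
import Literature.AlgebraicGeometry.Motives.RelativePeriodsProofs
import Literature.AlgebraicGeometry.HodgeTheory.HypersurfaceComplexPoints
import Literature.AlgebraicTopology.SingularHomology.RelativeCochainsMaps
import HarnessLib

/-!
# The mixed Hodge structure on the cohomology of a pair of varieties

Let `k ⊆ ℂ` be a subfield (`[Algebra k ℂ]`) and `(X, D)` a pair of `k`-varieties — a separated
`k`-scheme of finite type `X` with a closed subscheme `ι : D ↪ X` (the tree's
`Literature.AlgebraicGeometry.Motives.SchemePair`, `SchemePair.IsVarietyPair`). By Deligne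
(*Théorie de Hodge III*, §8.2 and 8.3.8–8.3.9; held restatements: Ishii, *Introduction to
Singularities*, Thm. 8.1.6; Jannsen, *Mixed Motives and Algebraic K-Theory*, §6.9, p. 82;
Cattani–El Zein–Griffiths–Lê, *Hodge Theory*, Thm. 3.4.1, Def. 3.4.23, Prop. 3.4.22, §3.4.2.12
Problem (1)) the relative singular cohomology `Hⁿ(X(ℂ), D(ℂ); ℚ)` carries a functorial mixed
`ℚ`-Hodge structure: pull-backs along morphisms of pairs and the connecting homomorphisms
`Hⁿ(D(ℂ); ℚ) → Hⁿ⁺¹(X(ℂ), D(ℂ); ℚ)` of the long exact sequence of the pair are morphisms of mixed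
Hodge structures, `Hⁿ(X(ℂ); ℚ)` is the classical pure Hodge structure of weight `n` when `X` is
smooth and projective, and the Hodge numbers `h^{p,q}` of `Hⁿ` vanish unless `0 ≤ p, q ≤ n`
(Hodge III, Thm. 8.2.4, with the exact sequence 8.3.9 for pairs; Cattani et al., Prop. 3.4.22
(iii)).

Following the two-speed design of `PeriodComparison.lean` / `RelativePeriods.lean`
(`PeriodRealization`, `RelativePeriodData`) and `BettiRealization.lean` (`BettiHodgeData`), this
enters the tree as a **hypothesis structure** `Literature.AlgebraicGeometry.Motives.MixedHodgeStructureOfPair k`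
whose fields are exactly the properties above, stated on the tree's honest relative singular
cohomology `relSingularCohomology ℚ ℚ (ComplexPoints X) (ι(D(ℂ))) n` (Hatcher §3.1;
`RelativeCochains.lean`) of the complex points with the analytic topology; the theorem that
Deligne's construction provides such a datum is the named fact
`MixedHodgeStructureOfPair.existsDeligne`. The abstract notion (weight and Hodge filtrations,
`Gr^W_k` as a pure `HodgeStructure`, Hodge numbers, bundled morphisms `Hom`, `IsPure`) is the
tree's `MixedHodgeStructure.lean`; the **level** of a mixed Hodge structure
(`MixedHodgeStructure.level`, max of `|p - q|` over the non-zero pieces of the `Gr^W_k`) is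
defined here.

## Main definitions

* `SchemePair.bettiCohomology Y n = Hⁿ(X(ℂ), D(ℂ); ℚ)` (an `abbrev` for the tree's
  `relSingularCohomology`), `SchemePair.bettiCohomology.map f n` (pull-back along a morphism of
  pairs, functorial: `map_id`, `map_comp`), `SchemePair.subHomeomorph Y : D(ℂ) ≃ₜ ι(D(ℂ))`,
  `SchemePair.bettiCohomology.boundary Y n : Hⁿ((D, ∅)) ⟶ Hⁿ⁺¹((X, D))` (the connecting
  homomorphism of the pair, Hatcher §3.1 p. 200, with source rewritten as the pair `(D, ∅)`).
* `MixedHodgeStructure.level H`, `level_le_of_forall`: the level of a mixed Hodge structure.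
* `MixedHodgeStructureOfPair k`: the hypothesis structure (fields `mhs`, `map_hom`,
  `boundary_hom`, `isPure`, `piece_eq_bot_of_not_mem_box`); `mapHom`, `boundaryHom` (the chosen
  morphisms of mixed Hodge structures with prescribed linear maps).
* `MixedHodgeStructureOfPair.level M Y n`, `hodgeNumber`: the level / Hodge numbers of
  `Hⁿ(X(ℂ), D(ℂ); ℚ)`; `level_le : level ≤ n`; `piece_eq_bot_of_weight_not_mem : Gr^W_w = 0`
  piecewise for `w ∉ [0, 2n]` (the "weight box"); `SchemePair.IsVarietyPair.ofScheme_X`,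
  `SchemePair.IsVarietyPair.ofScheme_D` (the pairs `(X, ∅)`, `(D, ∅)` are pairs of varieties).
* `MixedHodgeStructureOfPair.existsDeligne` (named fact): Deligne's mixed Hodge structures
  satisfy the axioms, for every subfield `k ⊆ ℂ`.

## Design notes

* Mathlib has no mixed Hodge theory and no singular cohomology of schemes; everything rests on
  the tree (`SchemePair`, `ComplexPoints`, `relSingularCohomology`, `MixedHodgeStructure`). The
  base field enters only through `ComplexPoints` (`[Algebra k ℂ]`, as in `BettiHodgeData`);
  users holding an embedding `σ : K →+* ℂ` (as in `RelativePeriodData`) apply the structure over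
  `k = ℂ` to `Y.baseChange σ`, whose `pointsSub ℂ` is `Y.complexPointsSub σ` by `rfl`.
* As in `RelativePeriodData`, the datum `mhs` is given for all pairs and the axioms only for
  pairs of varieties (`IsVarietyPair`); off pairs of varieties nothing is asserted.
* The long exact sequence of the pair in the tree (`RelativeCochains.lean`) runs through the
  absolute cohomology of `X(ℂ)` and of the subspace `ι(D(ℂ))`; to stay inside pairs we use the
  morphisms of pairs `(X, ∅) → (X, D)` and `(D, ∅) → (X, ∅)` (covered by `map_hom`) and rewrite
  the source of the connecting map as `Hⁿ((D, ∅))` along `toAbsolute` and the homeomorphism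
  `D(ℂ) ≃ₜ ι(D(ℂ))` (`AlgPoints.isEmbedding_map_of_isClosedImmersion`): this is `boundary`, and
  `boundary_hom` is Deligne's statement that the connecting morphism is a morphism of mixed
  Hodge structures. Exactness itself is topology (the tree's `exact_toAbsolute_map`,
  `exact_map_δ`, `exact_δ_toAbsolute`; pair form in `SchemePairLongExactSequence.lean`), not an
  axiom. Only the sequence of the pair is covered, not that of a triple `E ⊆ D ⊆ X`.
* No compatibility is asserted between `M.mhs (ofScheme X) n` (pure of weight `n` for `X` smooth
  projective, `isPure`) and the pure Hodge structures `B.hodge hX n` of a `BettiHodgeData`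
  (`BettiRealization.lean`) on the same `Hⁿ(X(ℂ); ℚ)` (up to `toAbsolute`): the two hypothesis
  structures are independent; a user needing both adds the agreement of the Hodge filtrations as
  a further hypothesis.
* Universally quantified consequences `∀ M : MixedHodgeStructureOfPair k, …` are only as strong
  as the axioms: statements about the classical mixed Hodge structure that do not follow from
  the listed properties (e.g. the description of `Gr^W Hⁿ(X ∖ E)` by residues along a normal
  crossings divisor, Deligne, Hodge II, 3.2.5–3.2.8) must be added as further hypotheses by
  their users; they are deliberately NOT fields here (no normal-crossings strata / Tate-twist
  vocabulary for mixed Hodge structures in the tree yet). Also NOT here: compatibility of `F`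
  with the Hodge filtration of relative algebraic de Rham cohomology under the period pairing of
  `RelativePeriodData` (which carries no Hodge filtration), cup products, duality.

## References

* P. Deligne, *Théorie de Hodge III*, Publ. Math. IHÉS 44 (1974): Thm. 8.2.4, 8.3.8–8.3.9.
* S. Ishii, *Introduction to Singularities*, 2nd ed., Springer (2018), Def. 8.1.2–8.1.3,
  Prop. 8.1.4, Thm. 8.1.6 (Deligne's theorem for pairs, items (i)–(vi)).
* U. Jannsen, *Mixed Motives and Algebraic K-Theory*, LNM 1400 (1990), §6.9, p. 82.
* E. Cattani, F. El Zein, P. Griffiths, Lê D. T. (eds.), *Hodge Theory* (2014), Ch. 3: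
  Thm. 3.4.1, Prop. 3.4.8, Prop. 3.4.22, Def. 3.4.23, §3.4.2.12 Problem (1).
* A. Hatcher, *Algebraic Topology* (2002), §3.1, pp. 199–200.
-/

noncomputable section

open CategoryTheory AlgebraicGeometry Topology
open Literature.AlgebraicTopology.SingularHomology

universe u

namespace Literature.AlgebraicGeometry.Motives

namespace SchemePair

section General

/-! ### Two canonical morphisms of pairs; closed parts of pairs of varieties -/

variable {k : Type u} [Field k] {Y : SchemePair k}

variable (Y) in
/-- The canonical morphism of pairs `(X, ∅) ⟶ (X, D)` (identity on `X`); it induces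
`Hⁿ(X(ℂ), D(ℂ)) → Hⁿ(X(ℂ), ∅) = Hⁿ(X(ℂ))`, the first map of the long exact sequence of the pair
(Hatcher 2002, §3.1 p. 200, `j^*`). Together with `Hom.ofScheme Y.ι : (D, ∅) ⟶ (X, ∅)`
(restriction) and `bettiCohomology.boundary` this writes the long exact sequence of the pair
inside the category of pairs. [cite: Hatcher2002, §3.1 p. 200] -/
def ofSchemeHom : ofScheme Y.X ⟶ Y :=
  ⟨𝟙 Y.X, Over.homMk (Scheme.emptyTo _) (Scheme.empty_ext _ _),
    Over.OverMorphism.ext (Scheme.empty_ext _ _)⟩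

/-- The `X`-component of `ofSchemeHom` is the identity (by `rfl`). [folklore] -/
@[simp] lemma ofSchemeHom_fX : (ofSchemeHom Y).fX = 𝟙 Y.X := rfl

/-- If `(X, D)` is a pair of varieties then so is `(X, ∅)` (same ambient scheme); together with
`IsVarietyPair.ofScheme_D` this makes statements about pairs of varieties available on all three
terms `Hⁿ((X, D))`, `Hⁿ((X, ∅))`, `Hⁿ((D, ∅))` of the long exact sequence of the pair. [folklore] -/
lemma IsVarietyPair.ofScheme_X (hY : Y.IsVarietyPair) : (ofScheme Y.X).IsVarietyPair :=
  ⟨hY.isSeparated, hY.locallyOfFiniteType, hY.quasiCompact⟩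

/-- If `(X, D)` is a pair of varieties then so is `(D, ∅)`: a closed subscheme of a separated
`k`-scheme of finite type is separated and of finite type (Hartshorne II.4, Cor. 4.6;
Mathlib's stability of these classes under composition with a closed immersion). [folklore] -/
lemma IsVarietyPair.ofScheme_D (hY : Y.IsVarietyPair) : (ofScheme Y.D).IsVarietyPair := by
  haveI := hY.isSeparated
  haveI := hY.locallyOfFiniteType
  haveI := hY.quasiCompact
  have hD : Y.D.hom = Y.ι.left ≫ Y.X.hom := (Over.w Y.ι).symm
  refine ⟨?_, ?_, ?_⟩
  · change IsSeparated Y.D.hom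
    rw [hD]; infer_instance
  · change LocallyOfFiniteType Y.D.hom
    rw [hD]; infer_instance
  · change QuasiCompact Y.D.hom
    rw [hD]; infer_instance

end General

variable {k : Type} [Field k] [Algebra k ℂ]

/-! ### Relative Betti cohomology of a pair -/

/-- The **relative Betti cohomology** `Hⁿ(X(ℂ), D(ℂ); ℚ)` of a pair `Y = (X, D)` over `k ⊆ ℂ`:
rational singular cohomology of the complex points `X(ℂ)` (analytic topology) relative to the
closed subspace `ι(D(ℂ))` (Hatcher 2002, §3.1; Deligne, Hodge III, 8.3.8; Huber–Müller-Stach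
2017, §2.1). An `abbrev` for the tree's `relSingularCohomology`. [folklore] -/
abbrev bettiCohomology (Y : SchemePair k) (n : ℕ) : ModuleCat.{0} ℚ :=
  relSingularCohomology ℚ ℚ (ComplexPoints Y.X) (Y.pointsSub ℂ) n

variable {Y Y' Y'' : SchemePair k}

/-- A morphism of pairs is a map of pairs `(X(ℂ), ι D(ℂ)) → (X'(ℂ), ι' D'(ℂ))` on complex
points (`Hom.mapsTo_pointsSub`, restated for the bundled continuous map `mapContinuous`).
[folklore] -/
lemma Hom.mapsTo_pointsSub_mapContinuous (f : Y ⟶ Y') :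
    Set.MapsTo (AlgPoints.mapContinuous (L := ℂ) f.fX) (Y.pointsSub ℂ) (Y'.pointsSub ℂ) :=
  SchemePair.Hom.mapsTo_pointsSub ℂ f

/-- Pull-back `f^* : Hⁿ(X'(ℂ), D'(ℂ)) ⟶ Hⁿ(X(ℂ), D(ℂ))` along a morphism of pairs `f : Y ⟶ Y'`
(Hatcher 2002, §3.1 p. 200, maps of pairs). [cite: Hatcher2002, §3.1 p. 200] -/
abbrev bettiCohomology.map (f : Y ⟶ Y') (n : ℕ) : Y'.bettiCohomology n ⟶ Y.bettiCohomology n :=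
  relSingularCohomology.map ℚ ℚ (AlgPoints.mapContinuous (L := ℂ) f.fX)
    (Hom.mapsTo_pointsSub_mapContinuous f) n

/-- `(𝟙 Y)^* = 𝟙`. [folklore] -/
@[simp]
lemma bettiCohomology.map_id (Y : SchemePair k) (n : ℕ) : bettiCohomology.map (𝟙 Y) n = 𝟙 _ :=
  (relSingularCohomology.map_congr (AlgPoints.mapContinuous_id Y.X) _ (Set.mapsTo_id _) n).trans
    (relSingularCohomology.map_id _ n)

/-- `(f ≫ g)^* = g^* ≫ f^*`. [folklore] -/
@[reassoc]
lemma bettiCohomology.map_comp (f : Y ⟶ Y') (g : Y' ⟶ Y'') (n : ℕ) :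
    bettiCohomology.map (f ≫ g) n = bettiCohomology.map g n ≫ bettiCohomology.map f n :=
  (relSingularCohomology.map_congr (AlgPoints.mapContinuous_comp f.fX g.fX) _
      ((Hom.mapsTo_pointsSub_mapContinuous g).comp (Hom.mapsTo_pointsSub_mapContinuous f)) n).trans
    (relSingularCohomology.map_comp _ _ _ _ n)

/-! ### The connecting homomorphism with source the pair `(D, ∅)` -/


variable (Y) in
/-- The homeomorphism `D(ℂ) ≃ₜ ι(D(ℂ)) ⊆ X(ℂ)`: a closed immersion induces a topological
embedding on complex points (`AlgPoints.isEmbedding_map_of_isClosedImmersion`; Serre, GAGA §2).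
[folklore] -/
def subHomeomorph : ComplexPoints Y.D ≃ₜ ↥(Y.pointsSub ℂ) :=
  (AlgPoints.isEmbedding_map_of_isClosedImmersion (L := ℂ) Y.ι).toHomeomorph

/-- `subHomeomorph` is `ι` on points. [folklore] -/
@[simp]
lemma subHomeomorph_apply_coe (P : ComplexPoints Y.D) :
    (Y.subHomeomorph P : ComplexPoints Y.X) = AlgPoints.map Y.ι P := rfl

variable (Y) in
/-- The **connecting homomorphism of the pair** with source rewritten as the pair `(D, ∅)`:
`∂ : Hⁿ(D(ℂ), ∅; ℚ) → Hⁿ(D(ℂ); ℚ) ≅ Hⁿ(ι(D(ℂ)); ℚ) --δ--> Hⁿ⁺¹(X(ℂ), D(ℂ); ℚ)`, the composite of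
`toAbsolute`, the pull-back along `subHomeomorph⁻¹`, and the tree's connecting map `δ` of the
pair `(X(ℂ), ι(D(ℂ)))` (Hatcher 2002, §3.1 p. 200). [cite: Hatcher2002, §3.1 p. 200] -/
def bettiCohomology.boundary (n : ℕ) :
    (ofScheme Y.D).bettiCohomology n ⟶ Y.bettiCohomology (n + 1) :=
  relSingularCohomology.toAbsolute ℚ ℚ (ComplexPoints Y.D) ((ofScheme Y.D).pointsSub ℂ) n ≫
    singularCohomology.map ℚ ℚ (Y.subHomeomorph.symm : C(↥(Y.pointsSub ℂ), ComplexPoints Y.D)) n ≫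
      relSingularCohomology.δ ℚ ℚ (ComplexPoints Y.X) (Y.pointsSub ℂ) n (n + 1) rfl


end SchemePair

/-! ### The level of a mixed Hodge structure -/

namespace MixedHodgeStructure

universe v

variable {V : Type v} [AddCommGroup V] [Module ℚ V]

/-- The **level** of a mixed Hodge structure: the largest `|p - q|` with `(Gr^W_{p+q})^{p,q} ≠ 0`,
i.e. the maximum over the weights `k` of the levels (`HodgeStructure.level`, Grothendieck 1969,
the invariant of the generalized Hodge conjecture) of the pure Hodge structures `Gr^W_k`
(`MixedHodgeStructure.gr`). Junk value `0` if no piece is non-zero (`V = 0`) or if the set is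
unbounded; `level_le_of_forall` is the usable introduction rule. Declared here, in the namespace
of the tree's `MixedHodgeStructure` (file `MixedHodgeStructure.lean`, which carries `gr`,
`hodgeNumber`, `Hom`, `IsPure` but no level). [folklore] -/
def level (H : MixedHodgeStructure V) : ℕ :=
  sSup {m : ℕ | ∃ p q : ℤ, (H.gr (p + q)).piece p q ≠ ⊥ ∧ m = (p - q).natAbs}

/-- To bound the level by `m` it suffices to bound `|p - q|` on the non-zero Hodge pieces of the
`Gr^W_k` (this also covers the junk cases, `csSup_le'`). [folklore] -/
theorem level_le_of_forall (H : MixedHodgeStructure V) {m : ℕ}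
    (h : ∀ p q : ℤ, (H.gr (p + q)).piece p q ≠ ⊥ → (p - q).natAbs ≤ m) : H.level ≤ m :=
  csSup_le' (by
    rintro _ ⟨p, q, hpq, rfl⟩
    exact h p q hpq)

end MixedHodgeStructure

/-! ### The hypothesis structure -/

/-- **Mixed Hodge structures on the cohomology of pairs** over a subfield `k ⊆ ℂ`: a hypothesis
structure standing in for Deligne's theorem (*Théorie de Hodge III*, §8.2, 8.3.8–8.3.9; Ishii,
*Introduction to Singularities*, Thm. 8.1.6 (i)–(vi); Jannsen 1990, §6.9). It assigns to every
pair `Y = (X, D)` and degree `n` a mixed `ℚ`-Hodge structure on `Hⁿ(X(ℂ), D(ℂ); ℚ)` such that, on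
pairs of varieties: pull-backs along morphisms of pairs underlie morphisms of mixed Hodge
structures (Ishii 8.1.6 (ii), (iv)); the connecting homomorphisms `Hⁿ(D) → Hⁿ⁺¹(X, D)` underlie
morphisms of mixed Hodge structures (Ishii 8.1.6 (iii); Hodge III, 8.3.9); for `X` smooth
projective, `Hⁿ(X(ℂ); ℚ) = Hⁿ((X, ∅))` is pure of weight `n` (Ishii 8.1.6 (i); Hodge II, 3.2.5
ff.); and the Hodge numbers `h^{p,q}` of `Hⁿ(X(ℂ), D(ℂ))` vanish unless `0 ≤ p, q ≤ n` (Hodge III,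
Thm. 8.2.4 for `X` and `D`, transported to the pair by the exact sequence 8.3.9 and exactness of
`(p, q)`-components, Ishii Prop. 8.1.4; Cattani et al., Prop. 3.4.22 (iii)). Morphisms are the
tree's bundled `MixedHodgeStructure.Hom`; "underlies a morphism" is stated as
`∃ φ : Hom _ _, φ.toLinearMap = f`, as in `BettiHodgeData.pullback_hom`.
[cite: IshiiSingularities2018, Thm. 8.1.6] -/
structure MixedHodgeStructureOfPair (k : Type) [Field k] [Algebra k ℂ] where
  /-- The mixed Hodge structure on `Hⁿ(X(ℂ), D(ℂ); ℚ)` (Hodge III, 8.3.8). -/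
  mhs (Y : SchemePair k) (n : ℕ) : MixedHodgeStructure (Y.bettiCohomology n)
  /-- Pull-back along a morphism of pairs of varieties underlies a morphism of mixed Hodge
  structures (Ishii 8.1.6 (iv); Hodge III, 8.3.9 "fonctorielle"). -/
  map_hom : ∀ ⦃Y Y' : SchemePair k⦄, Y.IsVarietyPair → Y'.IsVarietyPair → ∀ (f : Y ⟶ Y') (n : ℕ),
    ∃ φ : MixedHodgeStructure.Hom (mhs Y' n) (mhs Y n),
      φ.toLinearMap = (SchemePair.bettiCohomology.map f n).hom
  /-- The connecting homomorphism `Hⁿ((D, ∅)) → Hⁿ⁺¹((X, D))` of a pair of varieties underlies a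
  morphism of mixed Hodge structures (Ishii 8.1.6 (iii); Hodge III, 8.3.9). Only the long exact
  sequence of the PAIR `(X, D)` is covered here (its other two maps are pull-backs along
  `SchemePair.ofSchemeHom Y` and `SchemePair.Hom.ofScheme Y.ι`, instances of `map_hom`); the
  sequence of a triple `E ⊆ D ⊆ X` is not stated. -/
  boundary_hom : ∀ ⦃Y : SchemePair k⦄, Y.IsVarietyPair → ∀ n : ℕ,
    ∃ φ : MixedHodgeStructure.Hom (mhs (SchemePair.ofScheme Y.D) n) (mhs Y (n + 1)),
      φ.toLinearMap = (SchemePair.bettiCohomology.boundary Y n).hom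
  /-- For `X` smooth projective, `Hⁿ(X(ℂ); ℚ)` is pure of weight `n` (Ishii 8.1.6 (i);
  Deligne, Hodge II, 3.2.5 ff. / Hodge III, 8.2.4 (ii)–(iii)). -/
  isPure : ∀ ⦃d : ℕ⦄ ⦃X : SchemeOver k⦄, IsSmoothProjective d X → ∀ n : ℕ,
    (mhs (SchemePair.ofScheme X) n).IsPure n
  /-- The Hodge numbers of `Hⁿ(X(ℂ), D(ℂ); ℚ)` vanish outside the box `0 ≤ p, q ≤ n`: every Hodge
  piece `(Gr^W_{p+q})^{p,q}` with `(p, q) ∉ [0, n]²` is zero (Hodge III, Thm. 8.2.4 with 8.3.9;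
  Cattani et al., Prop. 3.4.22 (iii)). -/
  piece_eq_bot_of_not_mem_box : ∀ ⦃Y : SchemePair k⦄, Y.IsVarietyPair → ∀ (n : ℕ) (p q : ℤ),
    ¬(0 ≤ p ∧ p ≤ n ∧ 0 ≤ q ∧ q ≤ n) → ((mhs Y n).gr (p + q)).piece p q = ⊥

namespace MixedHodgeStructureOfPair

variable {k : Type} [Field k] [Algebra k ℂ] (M : MixedHodgeStructureOfPair k)

/-- The morphism of mixed Hodge structures `Hⁿ((X', D')) → Hⁿ((X, D))` underlying the pull-back
along a morphism `f : (X, D) ⟶ (X', D')` of pairs of varieties (a choice of the witness of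
`map_hom`; its linear map is `f^*`, `mapHom_toLinearMap`). [cite: IshiiSingularities2018, Thm. 8.1.6 (iv)] -/
def mapHom {Y Y' : SchemePair k} (hY : Y.IsVarietyPair) (hY' : Y'.IsVarietyPair) (f : Y ⟶ Y')
    (n : ℕ) : MixedHodgeStructure.Hom (M.mhs Y' n) (M.mhs Y n) :=
  (M.map_hom hY hY' f n).choose

/-- The linear map underlying `mapHom` is the pull-back `f^*`. [folklore] -/
@[simp]
lemma mapHom_toLinearMap {Y Y' : SchemePair k} (hY : Y.IsVarietyPair) (hY' : Y'.IsVarietyPair)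
    (f : Y ⟶ Y') (n : ℕ) :
    (M.mapHom hY hY' f n).toLinearMap = (SchemePair.bettiCohomology.map f n).hom :=
  (M.map_hom hY hY' f n).choose_spec

/-- The morphism of mixed Hodge structures `Hⁿ((D, ∅)) → Hⁿ⁺¹((X, D))` underlying the connecting
homomorphism of a pair of varieties (a choice of the witness of `boundary_hom`).
[cite: IshiiSingularities2018, Thm. 8.1.6 (iii)] -/
def boundaryHom {Y : SchemePair k} (hY : Y.IsVarietyPair) (n : ℕ) :
    MixedHodgeStructure.Hom (M.mhs (SchemePair.ofScheme Y.D) n) (M.mhs Y (n + 1)) :=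
  (M.boundary_hom hY n).choose

/-- The linear map underlying `boundaryHom` is `bettiCohomology.boundary`. [folklore] -/
@[simp]
lemma boundaryHom_toLinearMap {Y : SchemePair k} (hY : Y.IsVarietyPair) (n : ℕ) :
    (M.boundaryHom hY n).toLinearMap = (SchemePair.bettiCohomology.boundary Y n).hom :=
  (M.boundary_hom hY n).choose_spec

/-- The **Hodge numbers** `h^{p,q}(Hⁿ(X(ℂ), D(ℂ)))` of a pair (those of `Gr^W_{p+q}`;
Cattani et al., §3.2.2.6). [cite: CattaniElZeinGriffithsLe2014, §3.2.2.6] -/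
def hodgeNumber (Y : SchemePair k) (n : ℕ) (p q : ℤ) : ℕ := (M.mhs Y n).hodgeNumber p q

/-- The **level** of the mixed Hodge structure on `Hⁿ(X(ℂ), D(ℂ); ℚ)`: the largest `|p - q|` over
the non-zero Hodge pieces of the `Gr^W_w Hⁿ` (`MixedHodgeStructure.level`; the invariant of
Grothendieck 1969, piece by piece). [folklore] -/
def level (Y : SchemePair k) (n : ℕ) : ℕ := (M.mhs Y n).level

/-- Unfolding `level`. [folklore] -/
lemma level_eq (Y : SchemePair k) (n : ℕ) : M.level Y n = (M.mhs Y n).level := rfl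

/-- A non-zero Hodge piece `(Gr^W_{p+q} Hⁿ(X, D))^{p,q}` of a pair of varieties has
`0 ≤ p, q ≤ n` (contrapositive of the axiom `piece_eq_bot_of_not_mem_box`; Hodge III, 8.2.4).
[cite: DeligneHodgeIII1974, Thm. 8.2.4] -/
lemma mem_box_of_piece_ne_bot {Y : SchemePair k} (hY : Y.IsVarietyPair) (n : ℕ) {p q : ℤ}
    (h : ((M.mhs Y n).gr (p + q)).piece p q ≠ ⊥) : 0 ≤ p ∧ p ≤ n ∧ 0 ≤ q ∧ q ≤ n := by
  by_contra hpq
  exact h (M.piece_eq_bot_of_not_mem_box hY n p q hpq)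

/-- **The level of `Hⁿ(X(ℂ), D(ℂ); ℚ)` is at most `n`** for a pair of varieties: a non-zero
`(p, q)`-piece has `0 ≤ p, q ≤ n`, whence `|p - q| ≤ n`. [cite: DeligneHodgeIII1974, Thm. 8.2.4] -/
theorem level_le {Y : SchemePair k} (hY : Y.IsVarietyPair) (n : ℕ) : M.level Y n ≤ n := by
  refine (M.mhs Y n).level_le_of_forall fun p q h => ?_
  obtain ⟨hp, hpn, hq, hqn⟩ := M.mem_box_of_piece_ne_bot hY n h
  omega

/-- **The weight box**: the Hodge pieces of `Gr^W_w Hⁿ(X(ℂ), D(ℂ); ℚ)` vanish for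
`w ∉ [0, 2n]` (a non-zero `(p, q)`-piece of `Gr^W_w` has `p + q = w` and `0 ≤ p, q ≤ n`;
Hodge III, 8.2.4: the weights of `Hⁿ` lie between `0` and `2n`). [cite: DeligneHodgeIII1974, Thm. 8.2.4] -/
theorem piece_eq_bot_of_weight_not_mem {Y : SchemePair k} (hY : Y.IsVarietyPair) (n : ℕ) {w : ℤ}
    (hw : w < 0 ∨ 2 * (n : ℤ) < w) (p q : ℤ) : ((M.mhs Y n).gr w).piece p q = ⊥ := by
  by_cases hpq : p + q = w
  · subst hpq
    by_contra h
    obtain ⟨hp, hpn, hq, hqn⟩ := M.mem_box_of_piece_ne_bot hY n h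
    omega
  · exact HodgeStructure.piece_eq_bot_of_add_ne _ hpq

/-- **Deligne's theorem** (named fact): for every subfield `k ⊆ ℂ`, Deligne's mixed Hodge
structures on the relative cohomology of pairs of `k`-varieties (computed on complex points)
satisfy the axioms of `MixedHodgeStructureOfPair k` — existence and functoriality (Hodge III,
8.3.8–8.3.9; Ishii, Thm. 8.1.6 (ii)–(iv)), purity for smooth projective varieties (Ishii,
Thm. 8.1.6 (i)), and the vanishing of `h^{p,q}` outside `[0, n]²` (Hodge III, Thm. 8.2.4). The tree
cannot name the classical construction (logarithmic de Rham complexes, simplicial resolutions,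
mixed cones: Cattani et al., §3.3–3.4), so the theorem is recorded as inhabitedness of the
hypothesis structure; discharging it means formalising Hodge II–III.
[cite: DeligneHodgeIII1974, 8.3.8–8.3.9 and Thm. 8.2.4] -/
def existsDeligne : Prop :=
  ∀ (k : Type) [Field k] [Algebra k ℂ], Nonempty (MixedHodgeStructureOfPair k)

end MixedHodgeStructureOfPair

end Literature.AlgebraicGeometry.Motives

end
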